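import Summits.QuantumFields.YangMills.Theorems.BalabanUVNodesN12ForestSliceCurved
import Summits.QuantumFields.YangMills.Theorems.BalabanUVNodesN12GuardedLinAvgRightInverseLeft
import HarnessLib

/-!
# BalabanUVNodes ∕ N12 — THE FOREST SLICE IN PRINT's LEFT-FIELD CURRENCY: dag-n12-w1's displayed letter `hR` ∕ (45) — «every datum `(Ū^{j_i}(U₀)(c_i)·y_i)_i` on the constrained
# bonds is `Q_{j_i}(U₀)` of a LEFT field `p̂·U₀`» — with `p̂` VANISHING ON EVERY PATH BOND of the rooted forest: at a guarded curved base from surjectivity there (the companion's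
# linearised gauge section + dag-n10-w1's G1 dictionary), and at the record's `𝐁_k(Z)` with the surjectivity discharged by name (flat; and one radius of guarded near-flat backgrounds)

Cell `pub-ymgap` (HUMAN RULINGS D-0062 ∕ D-0149), WIDTH SEAT `pub-ymgap-dag-n12-w3` g3 (node N12 = [B15]; key K1⁸ `stmt-QuantumFields-26907`, `--kind proof --supports … --as helper`;
count-neutral).  THEOREMS ONLY (0 `def`, 0 `instance`, 0 `sorry`); consumed BY NAME: this seat's `N12ForestSliceCurved.exists_forest_preimage_of_surjective_curved` ∕
`exists_forest_rightInverse_Bj_nearFlat_atRecord` ∕ `N12RootedForest.exists_rootedForest_Bj` ∕ `forest_F1`, dag-n10-w1's `N12GuardedLinAvgRightInverseLeft.dIterL_leftField_eq_of_suProj_qLin_eq`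
(G1) ∕ `N12GuardedChartDerivQLinJunction.fderiv_msChart_apply_eq_suProj_qLin` ∕ `N12GuardedLinAvgRightInverseBj.surjective_fderiv_msChart_Bj(_one)` ∕ `N07CritTangentConverse.smallBelow_of_plaqSmall`,
`N12GuardedChartDerivIterLin.exists_stokesThreshold` ∕ `plaqSmall_iter_one`, `T4AdjointCovarianceUnitary.specialUnitaryAd`.

WHY.  dag-n12-w1's `B15Prop1LinearisedKernelDictionary.hMin_atRecord_of_node00Letters` displays, per base field `U₀` and slice `S`, the letter
«`∀ τ, ∃ p, cplxVec p ∈ S ∧ ∀ i, dIterL j_i (↑U₀) (b ↦ p̂_b·U₀,b) c_i = ↑W_{j_i}(c_i)·τ̂_i`» ([Balaban1985Variational] (45), LEFT perturbations `exp(iA)·U₀`, (3) p. 278).  dag-n10-w1's G1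
supplies this shape with the slice `⊤`; for the FOREST slice the companion `N12ForestSliceCurved` gives the right-chart field `X` vanishing on the forest with `DΦ_{U₀}(0)X = τ`, and
`p̂ := Ad(U₀)X` — which vanishes wherever `X` does — solves the left-field equation by G1's `dIterL_leftField_eq_of_suProj_qLin_eq`.  What stays the consumer's (as in G1): the `SU(2)`
coordinates `p̂_b = Σ_a p_{b,a}E_a` ∕ `cplxVec p ∈ S` and the rewrite `Ū^{j}(U₀)(c) = W_j(c)` on the fibre (`AgreeOn`; §1 gives the `_of_agreeOn` form).

CONTENTS.  §1 ★★★ `exists_forest_leftField_of_surjective_curved` (guarded `U₀`, surjectivity of `DΦ_{U₀}(0)` DISPLAYED: every datum is reached by an `𝔰𝔲(N)`-valued LEFT field vanishing on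
the forest), ★★ `exists_forest_leftField_of_surjective_curved_of_agreeOn` (the same with the datum `W` of the fibre through `U₀` on the right-hand side).  §2 at the record's `𝐁_k(Z)`,
every `Z` (`2 ≤ M₁`, `1 ≤ k ≤ m + K`, cover divisibility): ★★★ `exists_forest_leftField_Bj_one_atRecord` (FLAT base, hypothesis-free: `∃ path`, (F1) ∧ (F2) ∧ (TREE) ∧ the left-field
letter with `p̂` vanishing on the forest), ★★★ `exists_forest_leftField_Bj_nearFlat_atRecord` (one forest, one `ρ′ > 0`, every guarded `U₀` with `‖↑U₀ − 1‖ < ρ′`).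

HONEST FRAMING.  Junction bookkeeping by name; the surjectivity at a general guarded `U₀` stays displayed in §1 (the exact curved-base statement the record's pinned minimiser needs —
dag-n12-w5's LOCATED-hU — once surjectivity there is known); §2's near-flat edition carries dag-n10-w1's GLOBAL guard `‖↑U₀ − 1‖ < ρ′`; `SU(2)` coordinates not produced; nothing of
Bałaban's estimates asserted; N12 NOT discharged; K1⁸ NOT closed; counts unmoved (typed 28∕28 · discharged 5∕27); one finite 𝕋⁴ programme at fixed ε — R4 closes the conditional rung
`BalabanLadder.UV` only; the Yang–Mills mass gap (Clay) is NOT proved by any of this; nothing continuum ∕ ℝ⁴ ∕ OS.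
-/

noncomputable section

namespace Summit.QuantumFields.YangMills.BalabanUVNodes.N12ForestSliceLeftField

open scoped BigOperators Matrix.Norms.L2Operator Topology
open Literature.MathematicalPhysics.QuantumFieldTheory.Balaban1983to89
open T4Continuum
open B15DeterminingSets
open BlockAveraging (blockAvg)
open ExpMeanLog (expMeanLogSU deltaSU)
open T4AdjointCovarianceUnitary (lieSU specialUnitaryAd)
open Node00
open Summit.QuantumFields.YangMills.Theorems.BlockAvgCorrector (stokesConst)
open Summit.QuantumFields.YangMills.BalabanUVNodes.N07CritTangentConverse (smallBelow_of_plaqSmall)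
open Summit.QuantumFields.YangMills.BalabanUVNodes.N12GuardedChartDerivQLinJunction (fderiv_msChart_apply_eq_suProj_qLin)
open Summit.QuantumFields.YangMills.BalabanUVNodes.N12GuardedChartDerivIterLin (exists_stokesThreshold plaqSmall_iter_one)
open Summit.QuantumFields.YangMills.BalabanUVNodes.N12GuardedLinAvgRightInverseLeft (dIterL_leftField_eq_of_suProj_qLin_eq)
open Summit.QuantumFields.YangMills.BalabanUVNodes.N12GuardedLinAvgRightInverseBj (surjective_fderiv_msChart_Bj_one surjective_fderiv_msChart_Bj)
open Summit.QuantumFields.YangMills.BalabanUVNodes.N12RootedForest (forest_F1 exists_rootedForest_Bj)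
open Summit.QuantumFields.YangMills.BalabanUVNodes.N12ForestSliceCurved (exists_forest_preimage_of_surjective_curved)

variable {F : T4Family} {N : ℕ} [NeZero N] {K k : ℕ}

/-! ## §1 The left-field letter on the forest slice at a guarded curved base -/

/-- ★★★ **dag-n12-w1's `hR` SHAPE ON THE FOREST SLICE AT A GUARDED CURVED BASE**: at `U₀` with `t₀`-small iterated averages below `k` (`stokesConst·t₀ < δ_N`) and `DΦ_{U₀}(0)` onto (NODE 00's
chart with its own datum), for a rooted forest with (F1) and roots ⊇ `R(𝐁, k)`: every `𝔰𝔲(N)`-datum `y` on the enumerated constrained bonds is `Q_{j_i}(↑U₀)` of a LEFT field `p̂·U₀` with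
`p̂` VANISHING ON EVERY PATH BOND — `p̂ := Ad(U₀)X` for the companion's right-chart preimage `X` (`exists_forest_preimage_of_surjective_curved`), read back by G1's
`dIterL_leftField_eq_of_suProj_qLin_eq`. [cite: Balaban1985Variational, (3)–(4) p.278, (44)–(45) p.285; Balaban1985Averaging, (11) p.19; Balaban1985RegularSpaces, (1.19) p.79] -/
theorem exists_forest_leftField_of_surjective_curved (𝔹 : DetSet (F.P K)) (hk : k ≤ (F.P K).m + (F.P K).K)
    {t₀ : ℝ} (ht₀ : 0 < t₀) (hstδ : stokesConst (F.P K) * t₀ < deltaSU (Fin N))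
    {U₀ : GaugeField (F.P K) 0 (SU N)} (hsm : ∀ i, i < k → PlaqSmall t₀ (Averaging.iter (avOfRecord F N K) i U₀))
    {path : Site (F.P K) 0 → List (LStep (F.P K) 0)}
    (hroot : ∀ r ∈ {z : Site (F.P K) 0 | ∃ j, j ≤ k ∧ ∃ c ∈ bondsOf (𝔹 j), (z = embIter j c.src ∨ z = embIter j c.tgt)}, path r = [])
    (hF1 : ∀ x, ∀ s ∈ path x, ∃ x' x'' : Site (F.P K) 0, path x'' = path x' ++ [s] ∧
      (s.fwd = true → s.bond.src = x' ∧ s.bond.tgt = x'') ∧ (s.fwd = false → s.bond.src = x'' ∧ s.bond.tgt = x'))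
    (hsurj : Function.Surjective (fderiv ℝ (msChart F N K k 𝔹 (avgFamily (avOfRecord F N K) U₀) U₀) 0))
    (y : Fin (constrCard 𝔹 k) → lieSU (Fin N)) :
    ∃ p : PBond (F.P K) 0 → lieSU (Fin N), (∀ x, ∀ s ∈ path x, p s.bond = 0) ∧
      ∀ i : Fin (constrCard 𝔹 k), dIterL (((constrEnum 𝔹 k).symm i).1 : ℕ) (coeField U₀)
          (fun b => (p b : Matrix (Fin N) (Fin N) ℂ) * (U₀ b : Matrix (Fin N) (Fin N) ℂ)) ((constrEnum 𝔹 k).symm i).2.1 =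
        ((avgFamily (avOfRecord F N K) U₀ ((constrEnum 𝔹 k).symm i).1 ((constrEnum 𝔹 k).symm i).2.1 : SU N) : Matrix (Fin N) (Fin N) ℂ) *
          (y i : Matrix (Fin N) (Fin N) ℂ) := by
  obtain ⟨X, hXS, hX⟩ := exists_forest_preimage_of_surjective_curved 𝔹 hk ht₀ hstδ hsm hroot hF1 hsurj y
  have hsb : SmallBelow (avOfRecord F N K) k U₀ := smallBelow_of_plaqSmall ht₀ hstδ hsm
  refine ⟨fun b => specialUnitaryAd (U₀ b) (X b), fun x s hs => by beta_reduce; rw [hXS x s hs, map_zero], fun i => ?_⟩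
  have hj : (((constrEnum 𝔹 k).symm i).1 : ℕ) ≤ k := Nat.le_of_lt_succ ((constrEnum 𝔹 k).symm i).1.isLt
  have hq : suProj N (qLin (((constrEnum 𝔹 k).symm i).1 : ℕ) U₀ X ((constrEnum 𝔹 k).symm i).2.1) = y i := by
    rw [← fderiv_msChart_apply_eq_suProj_qLin ht₀ hstδ hsm 𝔹 X i, hX]
  exact dIterL_leftField_eq_of_suProj_qLin_eq (hsb.mono hj) X _ hq

/-- ★★ **THE SAME WITH THE DATUM OF THE FIBRE ON THE RIGHT-HAND SIDE**: if `U₀` lies on the `𝐁`-fibre of a datum `W` (`AgreeOn 𝐁 (M˙U₀) W` — at the record `W = M˙(Q_k^{s*}Ṽ)` and `U₀` the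
minimiser), the left-field letter reads `… = ↑W_{j_i}(c_i)·↑y_i`, dag-n12-w1's `hR` verbatim up to `SU(2)` coordinates. [cite: Balaban1985Variational, (44)–(45) p.285; Balaban1988Convergent, (2.10)–(2.12) p.256] -/
theorem exists_forest_leftField_of_surjective_curved_of_agreeOn (𝔹 : DetSet (F.P K)) (hk : k ≤ (F.P K).m + (F.P K).K)
    {t₀ : ℝ} (ht₀ : 0 < t₀) (hstδ : stokesConst (F.P K) * t₀ < deltaSU (Fin N))
    {U₀ : GaugeField (F.P K) 0 (SU N)} (hsm : ∀ i, i < k → PlaqSmall t₀ (Averaging.iter (avOfRecord F N K) i U₀))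
    {W : MSField (F.P K) (SU N)} (hW : AgreeOn 𝔹 (avgFamily (avOfRecord F N K) U₀) W)
    {path : Site (F.P K) 0 → List (LStep (F.P K) 0)}
    (hroot : ∀ r ∈ {z : Site (F.P K) 0 | ∃ j, j ≤ k ∧ ∃ c ∈ bondsOf (𝔹 j), (z = embIter j c.src ∨ z = embIter j c.tgt)}, path r = [])
    (hF1 : ∀ x, ∀ s ∈ path x, ∃ x' x'' : Site (F.P K) 0, path x'' = path x' ++ [s] ∧
      (s.fwd = true → s.bond.src = x' ∧ s.bond.tgt = x'') ∧ (s.fwd = false → s.bond.src = x'' ∧ s.bond.tgt = x'))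
    (hsurj : Function.Surjective (fderiv ℝ (msChart F N K k 𝔹 (avgFamily (avOfRecord F N K) U₀) U₀) 0))
    (y : Fin (constrCard 𝔹 k) → lieSU (Fin N)) :
    ∃ p : PBond (F.P K) 0 → lieSU (Fin N), (∀ x, ∀ s ∈ path x, p s.bond = 0) ∧
      ∀ i : Fin (constrCard 𝔹 k), dIterL (((constrEnum 𝔹 k).symm i).1 : ℕ) (coeField U₀)
          (fun b => (p b : Matrix (Fin N) (Fin N) ℂ) * (U₀ b : Matrix (Fin N) (Fin N) ℂ)) ((constrEnum 𝔹 k).symm i).2.1 =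
        ((W ((constrEnum 𝔹 k).symm i).1 ((constrEnum 𝔹 k).symm i).2.1 : SU N) : Matrix (Fin N) (Fin N) ℂ) * (y i : Matrix (Fin N) (Fin N) ℂ) := by
  obtain ⟨p, hpS, hp⟩ := exists_forest_leftField_of_surjective_curved 𝔹 hk ht₀ hstδ hsm hroot hF1 hsurj y
  refine ⟨p, hpS, fun i => ?_⟩
  rw [hp i, hW _ _ ((constrEnum 𝔹 k).symm i).2.2]

/-! ## §2 At the record's `𝐁_k(Z)` -/

section Record

open Literature.MathematicalPhysics.QuantumFieldTheory.Balaban1983to89.B14.Eq213DetSet (Bj)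
open Literature.MathematicalPhysics.QuantumFieldTheory.Balaban1983to89.B14.Eq213MaximalDomains (side)

variable {M₁ : ℕ} {Z : Set (Site (F.P K) 0)}

/-- ★★★ **THE LEFT-FIELD LETTER ON THE FOREST SLICE AT THE FLAT BASE OF RECORD, HYPOTHESIS-FREE**: for `𝐁_k(Z)` (`2 ≤ M₁`, `1 ≤ k ≤ m + K`, cover divisibility) a rooted forest with (F1), (F2),
(TREE) at `R(𝐁_k(Z), k)` such that at `U₀ = 1` every `𝔰𝔲(N)`-datum on the constrained bonds is `Q_{j_i}(1)` of a left field `p̂` VANISHING ON THE FOREST (`Ū^j(1) = 1`; surjectivity by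
dag-n10-w1's `surjective_fderiv_msChart_Bj_one`, guard by `plaqSmall_iter_one`). [cite: Balaban1985Variational, (44)–(45) p.285, (4) p.278; Balaban1988Convergent, (2.13) pp.256–257] -/
theorem exists_forest_leftField_Bj_one_atRecord (hk : k ≤ (F.P K).m + (F.P K).K) (hk1 : 1 ≤ k) (hM2 : 2 ≤ M₁) (hdiv : side (F.P K).L M₁ k ∣ (F.P K).sitesPerDir 0) :
    ∃ path : Site (F.P K) 0 → List (LStep (F.P K) 0),
      (∀ x, ∀ s ∈ path x, ∃ x' x'' : Site (F.P K) 0, path x'' = path x' ++ [s] ∧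
        (s.fwd = true → s.bond.src = x' ∧ s.bond.tgt = x'') ∧ (s.fwd = false → s.bond.src = x'' ∧ s.bond.tgt = x')) ∧
      (∀ j, j ≤ k → ∀ c ∈ bondsOf ((Bj M₁ Z k : DetSet (F.P K)) j), path (embIter j c.src) = [] ∧ path (embIter j c.tgt) = []) ∧
      (∀ x : Site (F.P K) 0, x ∉ {z : Site (F.P K) 0 | ∃ j, j ≤ k ∧ ∃ c ∈ bondsOf ((Bj M₁ Z k : DetSet (F.P K)) j), (z = embIter j c.src ∨ z = embIter j c.tgt)} →
        ∃ (x' : Site (F.P K) 0) (s : LStep (F.P K) 0), path x = path x' ++ [s] ∧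
          (s.fwd = true → s.bond.src = x' ∧ s.bond.tgt = x) ∧ (s.fwd = false → s.bond.src = x ∧ s.bond.tgt = x')) ∧
      ∀ y : Fin (constrCard (Bj M₁ Z k : DetSet (F.P K)) k) → lieSU (Fin N), ∃ p : PBond (F.P K) 0 → lieSU (Fin N),
        (∀ x, ∀ s ∈ path x, p s.bond = 0) ∧
        ∀ i, dIterL (((constrEnum (Bj M₁ Z k : DetSet (F.P K)) k).symm i).1 : ℕ) (coeField (1 : GaugeField (F.P K) 0 (SU N)))
            (fun b => (p b : Matrix (Fin N) (Fin N) ℂ) * (((1 : GaugeField (F.P K) 0 (SU N)) b : SU N) : Matrix (Fin N) (Fin N) ℂ))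
            ((constrEnum (Bj M₁ Z k : DetSet (F.P K)) k).symm i).2.1 =
          ((avgFamily (avOfRecord F N K) (1 : GaugeField (F.P K) 0 (SU N)) ((constrEnum (Bj M₁ Z k : DetSet (F.P K)) k).symm i).1
              ((constrEnum (Bj M₁ Z k : DetSet (F.P K)) k).symm i).2.1 : SU N) : Matrix (Fin N) (Fin N) ℂ) * (y i : Matrix (Fin N) (Fin N) ℂ) := by
  obtain ⟨path, hF1, hF2, htree⟩ := exists_rootedForest_Bj (P := F.P K) (Z := Z) hk hk1 (le_trans (by norm_num) hM2) hdiv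
  have hroot : ∀ r ∈ {z : Site (F.P K) 0 | ∃ j, j ≤ k ∧ ∃ c ∈ bondsOf ((Bj M₁ Z k : DetSet (F.P K)) j), (z = embIter j c.src ∨ z = embIter j c.tgt)}, path r = [] := by
    rintro r ⟨j, hj, c, hc, rfl | rfl⟩
    · exact (hF2 j hj c hc).1
    · exact (hF2 j hj c hc).2
  obtain ⟨t₀, ht₀, hst⟩ := exists_stokesThreshold (P := F.P K) (N := N)
  exact ⟨path, hF1, hF2, htree, fun y => exists_forest_leftField_of_surjective_curved (Bj M₁ Z k) hk ht₀ hst (fun i _ => plaqSmall_iter_one ht₀ i) hroot hF1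
    (surjective_fderiv_msChart_Bj_one (F := F) (N := N) (K := K) (k := k) hM2 hk (Z := Z) hdiv) y⟩

/-- ★★★ **THE LEFT-FIELD LETTER ON THE FOREST SLICE AT EVERY GUARDED NEAR-FLAT BASE OF RECORD**: one rooted forest ((F1), (F2), (TREE) at `R(𝐁_k(Z), k)`) and one radius `ρ′ > 0` such that
at every `U₀` with `t₀`-small iterated averages below `k` (`stokesConst·t₀ < δ_N`) and `‖↑U₀ − 1‖ < ρ′`, every `𝔰𝔲(N)`-datum on the constrained bonds is `Q_{j_i}(↑U₀)` of a LEFT field `p̂·U₀`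
with `p̂` VANISHING ON THE FOREST (surjectivity by dag-n10-w1's `surjective_fderiv_msChart_Bj`). [cite: Balaban1985Variational, (44)–(46) p.285, (4) p.278; Balaban1985Averaging, Prop. 3 p.36, (11) p.19; Balaban1988Convergent, (2.13) pp.256–257] -/
theorem exists_forest_leftField_Bj_nearFlat_atRecord (hk : k ≤ (F.P K).m + (F.P K).K) (hk1 : 1 ≤ k) (hM2 : 2 ≤ M₁) (hdiv : side (F.P K).L M₁ k ∣ (F.P K).sitesPerDir 0) :
    ∃ (path : Site (F.P K) 0 → List (LStep (F.P K) 0)) (ρ' : ℝ), 0 < ρ' ∧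
      (∀ x, ∀ s ∈ path x, ∃ x' x'' : Site (F.P K) 0, path x'' = path x' ++ [s] ∧
        (s.fwd = true → s.bond.src = x' ∧ s.bond.tgt = x'') ∧ (s.fwd = false → s.bond.src = x'' ∧ s.bond.tgt = x')) ∧
      (∀ j, j ≤ k → ∀ c ∈ bondsOf ((Bj M₁ Z k : DetSet (F.P K)) j), path (embIter j c.src) = [] ∧ path (embIter j c.tgt) = []) ∧
      (∀ x : Site (F.P K) 0, x ∉ {z : Site (F.P K) 0 | ∃ j, j ≤ k ∧ ∃ c ∈ bondsOf ((Bj M₁ Z k : DetSet (F.P K)) j), (z = embIter j c.src ∨ z = embIter j c.tgt)} →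
        ∃ (x' : Site (F.P K) 0) (s : LStep (F.P K) 0), path x = path x' ++ [s] ∧
          (s.fwd = true → s.bond.src = x' ∧ s.bond.tgt = x) ∧ (s.fwd = false → s.bond.src = x ∧ s.bond.tgt = x')) ∧
      ∀ ⦃t₀ : ℝ⦄, 0 < t₀ → stokesConst (F.P K) * t₀ < deltaSU (Fin N) →
        ∀ U₀ : GaugeField (F.P K) 0 (SU N), (∀ i, i < k → PlaqSmall t₀ (Averaging.iter (avOfRecord F N K) i U₀)) → ‖coeField U₀ - 1‖ < ρ' →
          ∀ y : Fin (constrCard (Bj M₁ Z k : DetSet (F.P K)) k) → lieSU (Fin N), ∃ p : PBond (F.P K) 0 → lieSU (Fin N),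
            (∀ x, ∀ s ∈ path x, p s.bond = 0) ∧
            ∀ i, dIterL (((constrEnum (Bj M₁ Z k : DetSet (F.P K)) k).symm i).1 : ℕ) (coeField U₀)
                (fun b => (p b : Matrix (Fin N) (Fin N) ℂ) * (U₀ b : Matrix (Fin N) (Fin N) ℂ)) ((constrEnum (Bj M₁ Z k : DetSet (F.P K)) k).symm i).2.1 =
              ((avgFamily (avOfRecord F N K) U₀ ((constrEnum (Bj M₁ Z k : DetSet (F.P K)) k).symm i).1
                  ((constrEnum (Bj M₁ Z k : DetSet (F.P K)) k).symm i).2.1 : SU N) : Matrix (Fin N) (Fin N) ℂ) * (y i : Matrix (Fin N) (Fin N) ℂ) := by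
  obtain ⟨path, hF1, hF2, htree⟩ := exists_rootedForest_Bj (P := F.P K) (Z := Z) hk hk1 (le_trans (by norm_num) hM2) hdiv
  have hroot : ∀ r ∈ {z : Site (F.P K) 0 | ∃ j, j ≤ k ∧ ∃ c ∈ bondsOf ((Bj M₁ Z k : DetSet (F.P K)) j), (z = embIter j c.src ∨ z = embIter j c.tgt)}, path r = [] := by
    rintro r ⟨j, hj, c, hc, rfl | rfl⟩
    · exact (hF2 j hj c hc).1
    · exact (hF2 j hj c hc).2
  obtain ⟨ρ', hρ', hsurj⟩ := surjective_fderiv_msChart_Bj (F := F) (N := N) (K := K) (k := k) hM2 hk (Z := Z) hdiv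
  exact ⟨path, ρ', hρ', hF1, hF2, htree, fun t₀ ht₀ hstδ U₀ hsm hU y =>
    exists_forest_leftField_of_surjective_curved (Bj M₁ Z k) hk ht₀ hstδ hsm hroot hF1 (hsurj ht₀ hstδ U₀ hsm hU) y⟩

end Record

end Summit.QuantumFields.YangMills.BalabanUVNodes.N12ForestSliceLeftField

end
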